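import Summits.KontsevichZagierPeriods.KontsevichZagierPeriods.Theorems.KzOnePeriodsE1CMDeriv
import Literature.NumberTheory.Transcendental.CurvePeriodsPuncturedLineProofs
import Literature.NumberTheory.Transcendental.QuadraticRelationsLogarithmsIsotropicProofs

/-!
# G2S derivations, part 1: the plane model `y² = x⁶ + a x⁴ + b x² + c` and the forms `P dx/(2y)`

Sub-problem `KzOnePeriods` (the theorem of Huber–Wüstholz [cite: HuberWustholz2022, Thm 13.3 (2)
p.121]); helper lane of the kz1p derivation modules (cell pub-kz1p, seat 2, gen 16), opening the
genus-2 split class G2S after the `G0` / `E1` parts; part 2 is `KzOnePeriodsG2SPaths` (the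
involution `σ` and paths), part 3 `KzOnePeriodsG2SDerivation` (exactness, linearity, the packaged
relation theorems).  Everything is stated in the vocabulary of
`Literature.NumberTheory.Transcendental.CurvePeriods` (symbols `(Z, ω, γ)`, the elementary
relations (R1)–(R5) of [cite: HuberWustholz2022, §13.1 (A)–(B) p.120]).

Objects (all by `local notation3`, no definitions): the affine plane model
`C_{a,b,c} = {y² = f(x)}`, `f = x⁶ + a x⁴ + b x² + c` (`Cpl[a, b, c] : CurveData`), which is a smooth
affine curve over `ℚ̄` as soon as `a, b, c ∈ ℚ̄` and a Bézout pair `U f + V f′ = 1` (`U` even,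
`V` odd, scalar hypothesis `Bez`) is supplied (`smooth`: rank of the gradient, local `C¹`
parametrisations at `y ≠ 0` by a branch of `√f` and at the branch points `y = 0` by the local
inverse of `f`); the polynomial 1-forms `θ[μ, ν, π] = (½ P U y) dx + (P V) dy`, `P = Σ π_k x^k`,
which restrict to `P dx/(2y)` on every tangent line of `C` (`theta_tangent`) and have algebraic
coefficients (`hasAlgCoeffs_theta`); vectors of rational casts are algebraic (`isAlgebraic_vecQ` & co.,
used by the generated per-case files; `RoyWaldschmidt1997.isAlgebraic_ratCast`).
[cite: HuberWustholz2022, §13.1 (A)–(B) p.120, Thm 13.3 (2) p.121]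

No new axioms; no statements of the programme are cited.
-/

noncomputable section

open MvPolynomial Set Complex Filter Topology
open Literature.NumberTheory.Transcendental Literature.NumberTheory.Transcendental.CurvePeriods
open Summit.KontsevichZagierPeriods.KzOnePeriods.E1Derivation

namespace Summit.KontsevichZagierPeriods.KzOnePeriods.G2SDerivation

/-- The even sextic `f = x⁶ + a x⁴ + b x² + c ∈ ℂ[x, y]`. -/
local notation3 (prettyPrint := false) "fS[" a ", " b ", " c "]" =>
  ((X 0 : MvPolynomial (Fin 2) ℂ) ^ 6 + C a * X 0 ^ 4 + C b * X 0 ^ 2 + C c)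

/-- The affine plane model `C_{a,b,c} = {y² = f(x)} ⊂ 𝔸²` of the genus-2 curve (minus `∞±`). -/
local notation3 (prettyPrint := false) "Cpl[" a ", " b ", " c "]" =>
  (⟨2, 1, ![(X 1 : MvPolynomial (Fin 2) ℂ) ^ 2 - fS[a, b, c]]⟩ : CurveData)

/-- The polynomial `Σ_k π_k x^k ∈ ℂ[x, y]` with coefficient vector `π`. -/
local notation3 (prettyPrint := false) "Pol[" π "]" =>
  (∑ k, C (π k) * (X 0 : MvPolynomial (Fin 2) ℂ) ^ (k : ℕ))

/-- The even polynomial `U = Σ_{k<3} μ_k x^{2k}` (Bézout cofactor of `f`). -/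
local notation3 (prettyPrint := false) "Upol[" μ "]" =>
  (∑ k : Fin 3, C (μ k) * (X 0 : MvPolynomial (Fin 2) ℂ) ^ (2 * (k : ℕ)))

/-- The odd polynomial `V = Σ_{k<3} ν_k x^{2k+1}` (Bézout cofactor of `f′`). -/
local notation3 (prettyPrint := false) "Vpol[" ν "]" =>
  (∑ k : Fin 3, C (ν k) * (X 0 : MvPolynomial (Fin 2) ℂ) ^ (2 * (k : ℕ) + 1))

/-- `θ[μ, ν, π] = (½ P U y) dx + (P V) dy`, the polynomial representative of `P(x) dx/(2y)`. -/
local notation3 (prettyPrint := false) "θ[" μ ", " ν ", " π "]" =>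
  (![C (1 / 2 : ℂ) * Pol[π] * Upol[μ] * X 1, Pol[π] * Vpol[ν]] :
    Fin 2 → MvPolynomial (Fin 2) ℂ)

/-- The Bézout identity `U f + V f′ = 1` for `U = Σ μ_k x^{2k}`, `V = Σ ν_k x^{2k+1}` (scalar form). -/
local notation3 (prettyPrint := false) "Bez[" a ", " b ", " c ", " μ ", " ν "]" =>
  (∀ x : ℂ, (∑ k : Fin 3, μ k * x ^ (2 * (k : ℕ))) * (x ^ 6 + a * x ^ 4 + b * x ^ 2 + c) +
    (∑ k : Fin 3, ν k * x ^ (2 * (k : ℕ) + 1)) * (6 * x ^ 5 + 4 * a * x ^ 3 + 2 * b * x) = 1)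

variable {a b c : ℂ}

/-! ### The plane model: equations, gradient, tangent lines -/

/-- `f(z) = z₀⁶ + a z₀⁴ + b z₀² + c`. -/
theorem eval_fS (z : Fin 2 → ℂ) :
    eval z fS[a, b, c] = z 0 ^ 6 + a * z 0 ^ 4 + b * z 0 ^ 2 + c := by
  simp

/-- `∂f/∂x (z) = 6 z₀⁵ + 4a z₀³ + 2b z₀`. -/
theorem eval_pderiv_zero_fS (z : Fin 2 → ℂ) :
    eval z (pderiv 0 fS[a, b, c]) = 6 * z 0 ^ 5 + 4 * a * z 0 ^ 3 + 2 * b * z 0 := by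
  simp
  ring

/-- `∂f/∂y = 0`. -/
theorem pderiv_one_fS : pderiv 1 fS[a, b, c] = 0 := by
  simp [pderiv_X_of_ne (show (0 : Fin 2) ≠ 1 by decide)]

/-- `z ∈ C_{a,b,c} ↔ z₁² = f(z₀)`. -/
theorem mem_points_iff (z : Fin 2 → ℂ) :
    z ∈ Cpl[a, b, c].points ↔ z 1 ^ 2 = z 0 ^ 6 + a * z 0 ^ 4 + b * z 0 ^ 2 + c := by
  refine (CurveData.mem_points (Z := Cpl[a, b, c]) (z := z)).trans ?_
  simp [sub_eq_zero]

/-- The gradient of `y² − f`: `(−f′(x), 2y)`. -/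
theorem gradient_eq (z : Fin 2 → ℂ) :
    Cpl[a, b, c].gradient 0 z = ![-(6 * z 0 ^ 5 + 4 * a * z 0 ^ 3 + 2 * b * z 0), 2 * z 1] := by
  funext k
  simp only [CurveData.gradient, Matrix.cons_val_zero]
  fin_cases k
  · simp [pderiv_X_of_ne (show (1 : Fin 2) ≠ 0 by decide)]
    ring
  · simp [pderiv_X_of_ne (show (0 : Fin 2) ≠ 1 by decide)]

/-- The tangent line at `z`: `−f′(z₀) v₀ + 2 z₁ v₁ = 0`. -/
theorem mem_tangentSpace_iff (z v : Fin 2 → ℂ) :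
    v ∈ Cpl[a, b, c].tangentSpace z ↔
      -(6 * z 0 ^ 5 + 4 * a * z 0 ^ 3 + 2 * b * z 0) * v 0 + 2 * z 1 * v 1 = 0 := by
  simp only [CurveData.tangentSpace, mem_setOf_eq, Fin.forall_fin_one, Fin.sum_univ_two]
  rw [show (0 : Fin (Cpl[a, b, c]).m) = (0 : Fin 1) from rfl, gradient_eq]
  simp

/-! ### Scalar evaluations of the coefficient-vector polynomials -/

/-- `Pol[π](z) = Σ_k π_k z₀^k`. -/
theorem eval_Pol {N : ℕ} (π : Fin N → ℂ) (z : Fin 2 → ℂ) :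
    eval z Pol[π] = ∑ k, π k * z 0 ^ (k : ℕ) := by
  simp [map_sum]

/-- `Upol[μ](z) = Σ_k μ_k z₀^{2k}`. -/
theorem eval_Upol (μ : Fin 3 → ℂ) (z : Fin 2 → ℂ) :
    eval z Upol[μ] = ∑ k : Fin 3, μ k * z 0 ^ (2 * (k : ℕ)) := by
  simp [map_sum]

/-- `Vpol[ν](z) = Σ_k ν_k z₀^{2k+1}`. -/
theorem eval_Vpol (ν : Fin 3 → ℂ) (z : Fin 2 → ℂ) :
    eval z Vpol[ν] = ∑ k : Fin 3, ν k * z 0 ^ (2 * (k : ℕ) + 1) := by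
  simp [map_sum]

/-- `∂P/∂x (z) = Σ_k k π_k z₀^{k−1}`. -/
theorem eval_pderiv_zero_Pol {N : ℕ} (π : Fin N → ℂ) (z : Fin 2 → ℂ) :
    eval z (pderiv 0 Pol[π]) = ∑ k, π k * ((k : ℕ) : ℂ) * z 0 ^ ((k : ℕ) - 1) := by
  simp only [map_sum, pderiv_C_mul, pderiv_pow, pderiv_X_self, mul_one, map_mul, eval_C,
    map_natCast, map_pow, eval_X]
  exact Finset.sum_congr rfl fun k _ => by ring

/-- `∂P/∂y = 0`. -/
theorem pderiv_one_Pol {N : ℕ} (π : Fin N → ℂ) : pderiv 1 Pol[π] = 0 := by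
  simp [map_sum, pderiv_X_of_ne (show (0 : Fin 2) ≠ 1 by decide)]

/-! ### Coefficients in `ℚ̄` -/

/-- `f` has algebraic coefficients when `a, b, c ∈ ℚ̄`. -/
theorem hasAlgCoeffs_fS (ha : IsAlgebraic ℚ a) (hb : IsAlgebraic ℚ b) (hc : IsAlgebraic ℚ c) :
    HasAlgCoeffs fS[a, b, c] :=
  ((((hasAlgCoeffs_X (n := 2) 0).pow 6).add ((hasAlgCoeffs_C ha).mul ((hasAlgCoeffs_X 0).pow 4))).add
    ((hasAlgCoeffs_C hb).mul ((hasAlgCoeffs_X 0).pow 2))).add (hasAlgCoeffs_C hc)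

/-- The defining equation `y² − f` of `C_{a,b,c}` has algebraic coefficients. -/
theorem hasAlgCoeffs_F (ha : IsAlgebraic ℚ a) (hb : IsAlgebraic ℚ b) (hc : IsAlgebraic ℚ c) :
    ∀ j, HasAlgCoeffs (Cpl[a, b, c].F j) := by
  intro j
  fin_cases j
  simpa using ((hasAlgCoeffs_X (n := 2) 1).pow 2).sub (hasAlgCoeffs_fS ha hb hc)

/-- `Pol[π]` has algebraic coefficients when `π_k ∈ ℚ̄`. -/
theorem hasAlgCoeffs_Pol {N : ℕ} {π : Fin N → ℂ} (hπ : ∀ k, IsAlgebraic ℚ (π k)) :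
    HasAlgCoeffs Pol[π] :=
  hasAlgCoeffs_finsetSum _ _ fun k _ => (hasAlgCoeffs_C (hπ k)).mul ((hasAlgCoeffs_X 0).pow _)

/-- `Upol[μ]` has algebraic coefficients when `μ_k ∈ ℚ̄`. -/
theorem hasAlgCoeffs_Upol {μ : Fin 3 → ℂ} (hμ : ∀ k, IsAlgebraic ℚ (μ k)) : HasAlgCoeffs Upol[μ] :=
  hasAlgCoeffs_finsetSum _ _ fun k _ => (hasAlgCoeffs_C (hμ k)).mul ((hasAlgCoeffs_X 0).pow _)

/-- `Vpol[ν]` has algebraic coefficients when `ν_k ∈ ℚ̄`. -/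
theorem hasAlgCoeffs_Vpol {ν : Fin 3 → ℂ} (hν : ∀ k, IsAlgebraic ℚ (ν k)) : HasAlgCoeffs Vpol[ν] :=
  hasAlgCoeffs_finsetSum _ _ fun k _ => (hasAlgCoeffs_C (hν k)).mul ((hasAlgCoeffs_X 0).pow _)

/-- The form `θ[μ, ν, π]` is over `ℚ̄`. -/
theorem hasAlgCoeffs_theta {μ ν : Fin 3 → ℂ} (hμ : ∀ k, IsAlgebraic ℚ (μ k))
    (hν : ∀ k, IsAlgebraic ℚ (ν k)) {N : ℕ} {π : Fin N → ℂ} (hπ : ∀ k, IsAlgebraic ℚ (π k)) :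
    ∀ i, HasAlgCoeffs (θ[μ, ν, π] i) := by
  intro i
  fin_cases i
  · simpa using (((hasAlgCoeffs_C (n := 2) (by simpa using (isAlgebraic_nat 2).inv)).mul
      (hasAlgCoeffs_Pol hπ)).mul (hasAlgCoeffs_Upol hμ)).mul (hasAlgCoeffs_X 1)
  · simpa using (hasAlgCoeffs_Pol hπ).mul (hasAlgCoeffs_Vpol hν)

/-! ### `C_{a,b,c}` is a smooth affine curve over `ℚ̄` (given a Bézout pair `U f + V f′ = 1`) -/

/-- **Smoothness of the plane model.**  For algebraic `a, b, c` and a Bézout pair `U f + V f′ = 1`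
(so `f` is square-free), `C_{a,b,c}` is a smooth affine curve over `ℚ̄`: the gradient `(−f′, 2y)` cannot
vanish on the curve, and no point is isolated (a local square root of `f(x₀ + u)` where `y₀ ≠ 0`, the
holomorphic local inverse of `f` at the branch points `y₀ = 0`, `f′(x₀) ≠ 0`). -/
theorem smooth (ha : IsAlgebraic ℚ a) (hb : IsAlgebraic ℚ b) (hc : IsAlgebraic ℚ c)
    {μ ν : Fin 3 → ℂ} (hbez : Bez[a, b, c, μ, ν]) : Cpl[a, b, c].IsSmoothAffineCurve where
  algebraic := hasAlgCoeffs_F ha hb hc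
  rank_eq z hz := by
    rw [mem_points_iff] at hz
    have hrange : (Set.range fun j : Fin 1 => Cpl[a, b, c].gradient j z) =
        {Cpl[a, b, c].gradient 0 z} := by
      rw [Set.range_unique]
      rfl
    rw [hrange, gradient_eq]
    have hv : (![-(6 * z 0 ^ 5 + 4 * a * z 0 ^ 3 + 2 * b * z 0), 2 * z 1] : Fin 2 → ℂ) ≠ 0 := by
      intro h
      have h0 := congrFun h 0
      have h1 := congrFun h 1
      simp only [Matrix.cons_val_zero, Matrix.cons_val_one, Pi.zero_apply, neg_eq_zero,
        mul_eq_zero, OfNat.ofNat_ne_zero, false_or] at h0 h1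
      have hf : z 0 ^ 6 + a * z 0 ^ 4 + b * z 0 ^ 2 + c = 0 := by rw [← hz, h1]; ring
      have hB := hbez (z 0)
      rw [h0, hf, mul_zero, mul_zero, add_zero] at hB
      exact zero_ne_one hB
    exact finrank_span_singleton hv
  not_isolated z hz := by
    rw [mem_points_iff] at hz
    -- the sextic as a function, with its derivative
    obtain ⟨g, hg⟩ : ∃ g : ℂ → ℂ, g = fun x => x ^ 6 + a * x ^ 4 + b * x ^ 2 + c := ⟨_, rfl⟩
    have hgd : ∀ x, HasStrictDerivAt g (6 * x ^ 5 + 4 * a * x ^ 3 + 2 * b * x) x := fun x => by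
      rw [hg]
      have h := (((hasStrictDerivAt_pow 6 x).add ((hasStrictDerivAt_pow 4 x).const_mul a)).add
        ((hasStrictDerivAt_pow 2 x).const_mul b)).add_const c
      refine h.congr_deriv ?_
      push_cast
      ring
    have hgc : Continuous g := by rw [hg]; fun_prop
    have hgz : g (z 0) = z 1 ^ 2 := by rw [hg]; exact hz.symm
    by_cases hy : z 1 = 0
    · -- a branch point: parametrise by `y` via the local inverse of `f` at `x₀`
      have hf0 : g (z 0) = 0 := by rw [hgz, hy]; ring
      have hf'0 : 6 * z 0 ^ 5 + 4 * a * z 0 ^ 3 + 2 * b * z 0 ≠ 0 := by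
        intro h
        have hB := hbez (z 0)
        have : z 0 ^ 6 + a * z 0 ^ 4 + b * z 0 ^ 2 + c = 0 := by rw [← hz, hy]; ring
        rw [this, h, mul_zero, mul_zero, add_zero] at hB
        exact zero_ne_one hB
      have hF := (hgd (z 0)).hasStrictFDerivAt_equiv hf'0
      set ψ := hF.localInverse g _ (z 0) with hψ
      have hψc : ContinuousAt ψ 0 := by
        have h := hF.localInverse_continuousAt
        rwa [hf0] at h
      have hψ0 : ψ 0 = z 0 := by
        have h := hF.localInverse_apply_image
        rwa [hf0] at h
      have hright : ∀ᶠ w in 𝓝 (0 : ℂ), g (ψ w) = w := by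
        have h := hF.eventually_right_inverse
        rwa [hf0] at h
      -- the curve `v ↦ (ψ(v²), v)`
      obtain ⟨γ, hγ⟩ : ∃ γ : ℝ → (Fin 2 → ℂ), γ = fun v : ℝ => ![ψ ((v : ℂ) ^ 2), (v : ℂ)] :=
        ⟨_, rfl⟩
      have hsq : Tendsto (fun v : ℝ => (v : ℂ) ^ 2) (𝓝 0) (𝓝 0) := by
        have h : Continuous fun v : ℝ => (v : ℂ) ^ 2 := by fun_prop
        simpa using h.tendsto 0
      have hcc : Tendsto γ (𝓝 0) (𝓝 z) := by
        rw [hγ, tendsto_pi_nhds]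
        intro k
        fin_cases k
        · have h := hψc.tendsto.comp hsq
          rw [hψ0] at h
          simpa [Function.comp_def] using h
        · have h : Continuous fun v : ℝ => (v : ℂ) := by fun_prop
          simpa [hy] using h.tendsto 0
      refine mem_closure_of_tendsto (b := 𝓝[≠] (0 : ℝ)) (f := γ)
        (hcc.mono_left nhdsWithin_le_nhds) ?_
      have h1 : ∀ᶠ v : ℝ in 𝓝[≠] 0, g (ψ ((v : ℂ) ^ 2)) = (v : ℂ) ^ 2 :=
        (hsq.eventually hright).filter_mono nhdsWithin_le_nhds
      have h2 : ∀ᶠ v : ℝ in 𝓝[≠] 0, v ≠ 0 := eventually_nhdsWithin_of_forall fun v hv => hv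
      filter_upwards [h1, h2] with v hv1 hv2
      refine ⟨(mem_points_iff _).2 ?_, ?_⟩
      · rw [hγ]
        simp only [Matrix.cons_val_one, Matrix.cons_val_zero]
        have h := hv1
        simp only [hg] at h
        simpa using h.symm
      · intro h
        have h1' : γ v 1 = z 1 := congrFun h 1
        simp [hγ, hy] at h1'
        exact hv2 h1'
    · -- `y₀ ≠ 0`: a local square root of `f(x₀ + u)`
      have hy2 : z 1 ^ 2 ≠ 0 := pow_ne_zero 2 hy
      obtain ⟨w, hw⟩ : ∃ w : ℝ → ℂ, w = fun u : ℝ => g (z 0 + (u : ℂ)) / z 1 ^ 2 := ⟨_, rfl⟩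
      have hwc : Continuous w := by
        rw [hw]
        exact (hgc.comp (by fun_prop)).div_const _
      have hw0 : w 0 = 1 := by
        rw [hw]
        simp only [ofReal_zero, add_zero]
        rw [hgz, div_self hy2]
      obtain ⟨Y, hY⟩ : ∃ Y : ℝ → ℂ, Y = fun u : ℝ => z 1 * exp (log (w u) / 2) := ⟨_, rfl⟩
      have hYc : ContinuousAt Y 0 := by
        rw [hY]
        refine continuousAt_const.mul (ContinuousAt.cexp (ContinuousAt.div_const ?_ _))
        exact hwc.continuousAt.clog (by rw [hw0]; exact one_mem_slitPlane)
      have hY0 : Y 0 = z 1 := by rw [hY]; simp [hw0]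
      have hYsq : ∀ u, w u ≠ 0 → Y u ^ 2 = g (z 0 + (u : ℂ)) := fun u hu => by
        rw [hY]
        simp only
        rw [mul_pow, ← exp_nat_mul, show ((2 : ℕ) : ℂ) * (log (w u) / 2) = log (w u) by push_cast; ring,
          exp_log hu, hw]
        simp only
        field_simp
      obtain ⟨γ, hγ⟩ : ∃ γ : ℝ → (Fin 2 → ℂ), γ = fun u : ℝ => ![z 0 + (u : ℂ), Y u] := ⟨_, rfl⟩
      have hcc : Tendsto γ (𝓝 0) (𝓝 z) := by
        rw [hγ, tendsto_pi_nhds]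
        intro k
        fin_cases k
        · have h : Continuous fun u : ℝ => z 0 + (u : ℂ) := by fun_prop
          simpa using h.tendsto 0
        · have h := hYc.tendsto
          rw [hY0] at h
          simpa using h
      refine mem_closure_of_tendsto (b := 𝓝[≠] (0 : ℝ)) (f := γ)
        (hcc.mono_left nhdsWithin_le_nhds) ?_
      have h1 : ∀ᶠ u : ℝ in 𝓝[≠] 0, w u ≠ 0 :=
        (hwc.continuousAt.eventually_ne (by rw [hw0]; exact one_ne_zero)).filter_mono
          nhdsWithin_le_nhds
      have h2 : ∀ᶠ u : ℝ in 𝓝[≠] 0, u ≠ 0 := eventually_nhdsWithin_of_forall fun u hu => hu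
      filter_upwards [h1, h2] with u hu1 hu2
      refine ⟨(mem_points_iff _).2 ?_, ?_⟩
      · rw [hγ]
        simp only [Matrix.cons_val_one, Matrix.cons_val_zero]
        rw [hYsq u hu1]
        simp only [hg]
      · intro h
        have h0 := congrFun h 0
        simp only [hγ, Matrix.cons_val_zero, add_eq_left, ofReal_eq_zero] at h0
        exact hu2 h0


/-! ### Semantics: `θ[μ, ν, π]` restricts to `P(x) dx/(2y)` on tangent lines -/

/-- On a tangent vector `v` at a point `z` of the curve with `z₁ ≠ 0`,
`θ[μ, ν, π](v) = P(z₀) v₀ / (2 z₁)`: the form `θ` is the class of `P(x) dx/(2y)`. -/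
theorem theta_tangent {μ ν : Fin 3 → ℂ} (hbez : Bez[a, b, c, μ, ν]) {N : ℕ} (π : Fin N → ℂ)
    {z v : Fin 2 → ℂ} (hz : z ∈ Cpl[a, b, c].points) (hy : z 1 ≠ 0)
    (hv : v ∈ Cpl[a, b, c].tangentSpace z) :
    eval z (θ[μ, ν, π] 0) * v 0 + eval z (θ[μ, ν, π] 1) * v 1 =
      (∑ k, π k * z 0 ^ (k : ℕ)) * v 0 / (2 * z 1) := by
  rw [mem_points_iff] at hz
  rw [mem_tangentSpace_iff] at hv
  rw [eq_div_iff (mul_ne_zero two_ne_zero hy)]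
  simp only [Matrix.cons_val_zero, Matrix.cons_val_one, map_mul, eval_C,
    eval_X, eval_Pol, eval_Upol, eval_Vpol]
  have hB := hbez (z 0)
  linear_combination ((∑ k, π k * z 0 ^ (k : ℕ)) * (∑ k : Fin 3, μ k * z 0 ^ (2 * (k : ℕ))) *
      v 0) * hz + ((∑ k, π k * z 0 ^ (k : ℕ)) * ∑ k : Fin 3, ν k * z 0 ^ (2 * (k : ℕ) + 1)) * hv +
    ((∑ k, π k * z 0 ^ (k : ℕ)) * v 0) * hB

/-! ### Rational data -/

/-- A vector of rational casts is a vector of algebraic numbers. -/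
theorem isAlgebraic_vecQ {N : ℕ} (v : Fin N → ℚ) : ∀ k, IsAlgebraic ℚ ((v k : ℚ) : ℂ) :=
  fun k => RoyWaldschmidt1997.isAlgebraic_ratCast (v k)

/-- A matrix of rational casts is a matrix of algebraic numbers. -/
theorem isAlgebraic_matQ {m N : ℕ} (v : Fin m → Fin N → ℚ) :
    ∀ i k, IsAlgebraic ℚ ((v i k : ℚ) : ℂ) :=
  fun i k => RoyWaldschmidt1997.isAlgebraic_ratCast (v i k)

/-- A real number equal to a rational is algebraic (as a complex number). -/
theorem isAlgebraic_real_of_eq_ratCast {x : ℝ} (q : ℚ) (h : x = q) : IsAlgebraic ℚ ((x : ℝ) : ℂ) := by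
  rw [h, ofReal_ratCast]
  exact RoyWaldschmidt1997.isAlgebraic_ratCast q

end Summit.KontsevichZagierPeriods.KzOnePeriods.G2SDerivation

end
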